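import Mathlib
import Summits.AtomisticToContinuum.Crystallization.Theorems.ThreeConeCertificateExactCertificateTransfer1DBulkDefect

/-!
# Crux `ExactCertificate` (stmt-AtomisticToContinuum-11959), line `closure-makes-nogap-exact`,
# Transfer skeleton IV `SlackRigidity1D` — stub `stub_localCardBad`: the local matching count

Support file (`--supports stmt-AtomisticToContinuum-11959`) for the crux
`ThreeConeCertificate.ExactCertificate`, line `closure-makes-nogap-exact`, TRANSFER skeleton IV
`SlackRigidity1D` (slack rigidity of the Lennard-Jones chain: the route decl `SlackRigidity` with `3 ↦ 1`).
Nothing in this file closes the 3-D crux.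

This file proves the registered stub `stub_localCardBad` (step 5, LOCAL MATCHING COUNT, of the skeleton): the
theorem `pos1d_card_bad_le` of `…Transfer1DBulkDefect.lean` with the GLOBAL minimal-gap hypothesis (all gaps
`≥ 3/4`) and the defect bound `Σ (a − gap)² ≤ C` removed.  For a strictly increasing `y` enumerating (after the
permutation `σ`) an `N`-point configuration `x` of the line, with `K = ⌈2R⌉ + 1` and `η = min(ε/K, 1/4)`, the
number of particles whose `R`-environment is not two-way `ε`-matched to `x_i + aℤ` is at most
`2K + 2K·#{l < N − 1 : η < |a − (y (l+1) − y l)|}`.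

Mechanism.  A rank `j` with `K ≤ j`, `j + K < N` and `|gap_l − a| ≤ η` for all `j − K ≤ l < j + K` is a GOOD
particle (`slackCount_localMatching`, the local version of `stub_blockMatching`): those gaps are
`≥ a − 1/4 ≥ 1/2`, so by monotonicity ranks at index distance `≥ K` from `j` are farther than `K/2 > R`
(`slackCount_lower`), ranks within index distance `K` are cumulatively `Kη ≤ ε`-close to `x_j + aℤ`
(`blockMatching_upper`), and the sites `ka` with `|ka| ≤ R` have `|k| ≤ 4R/3 < K`.  Every other rank is within
`K` of an end or of an `η`-bad gap: at most `2K + 2K·#{η-bad gaps}` of them (`pos1d_card_window_le`).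
All `[folklore]`.
-/

noncomputable section

namespace Summit.AtomisticToContinuum.Crystallization.Theorems.ThreeConeCertificateExactCertificate.Transfer1D

open Literature.MathematicalPhysics.StatisticalMechanics
open scoped BigOperators

/-- Summing termwise lower bounds along a telescope: if each of the `k` consecutive gaps starting at `p` is
`≥ 1/2`, then `y (p + k) - y p ≥ k/2`. [folklore] -/
theorem slackCount_lower (y : ℕ → ℝ) (p k : ℕ)
    (h : ∀ l : ℕ, l < k → 1 / 2 ≤ y (p + l + 1) - y (p + l)) :
    (k : ℝ) / 2 ≤ y (p + k) - y p := by
  rw [blockMatching_telescope]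
  have hc : (k : ℝ) / 2 = ∑ _l ∈ Finset.range k, (1 / 2 : ℝ) := by
    rw [Finset.sum_const, Finset.card_range, nsmul_eq_mul]
    ring
  rw [hc]
  exact Finset.sum_le_sum fun l hl => h l (Finset.mem_range.mp hl)

/-- A map `y : ℕ → ℝ` that is strictly increasing on `range N` is monotone there. [folklore] -/
theorem slackCount_mono (N : ℕ) (y : ℕ → ℝ) (hmono : ∀ i j : ℕ, i < j → j < N → y i < y j)
    {i j : ℕ} (hij : i ≤ j) (hj : j < N) : y i ≤ y j := by
  rcases hij.lt_or_eq with h | rfl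
  · exact (hmono i j h hj).le
  · exact le_rfl

/-- LOCAL BLOCK MATCHING (the local version of `stub_blockMatching`, no global gap hypothesis): if `y` is strictly
increasing on `range N` and on the block of gap indices `[c - M, c + M)` (`M ≤ c`, `c + M < N`) every gap is
within `η ≤ 1/4` of `a ≥ 3/4` — so that those gaps are `≥ 1/2` — then every rank `i < N` with `c + M ≤ i` has
`y i - y c ≥ M/2`, every rank `i` with `i + M ≤ c` has `y c - y i ≥ M/2`, and
`|y i - y c - (i - c) a| ≤ M η` for `c - M ≤ i ≤ c + M`. [folklore] -/
theorem slackCount_localMatching (N c M : ℕ) (y : ℕ → ℝ) (a η : ℝ)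
    (hmono : ∀ i j : ℕ, i < j → j < N → y i < y j)
    (hblock : ∀ i : ℕ, c - M ≤ i → i < c + M → |y (i + 1) - y i - a| ≤ η)
    (hMc : M ≤ c) (hcMN : c + M < N) (hη : 0 ≤ η) (hη4 : η ≤ 1 / 4) (ha : 3 / 4 ≤ a) :
    (∀ i : ℕ, i < N → c + M ≤ i → (M : ℝ) / 2 ≤ y i - y c) ∧
    (∀ i : ℕ, i + M ≤ c → (M : ℝ) / 2 ≤ y c - y i) ∧
    (∀ i : ℕ, c - M ≤ i → i ≤ c + M → |y i - y c - ((i : ℝ) - c) * a| ≤ M * η) := by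
  have hgood : ∀ i : ℕ, c - M ≤ i → i < c + M → 1 / 2 ≤ y (i + 1) - y i := by
    intro i hi1 hi2
    have h' := (abs_le.1 (hblock i hi1 hi2)).1
    linarith
  refine ⟨fun i hiN hi => ?_, fun i hi => ?_, fun i hi1 hi2 => ?_⟩
  · -- far to the right: `y i ≥ y (c + M) ≥ y c + M/2`
    have hlow : (M : ℝ) / 2 ≤ y (c + M) - y c :=
      slackCount_lower y c M fun l hl => hgood (c + l) (by omega) (by omega)
    have hmn : y (c + M) ≤ y i := slackCount_mono N y hmono hi hiN
    linarith
  · -- far to the left: `y i ≤ y (c - M) ≤ y c - M/2`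
    have hlow : (M : ℝ) / 2 ≤ y (c - M + M) - y (c - M) :=
      slackCount_lower y (c - M) M fun l hl => hgood (c - M + l) (by omega) (by omega)
    rw [Nat.sub_add_cancel hMc] at hlow
    have hmn : y i ≤ y (c - M) := slackCount_mono N y hmono (by omega) (by omega)
    linarith
  · -- near: cumulative closeness, as in `stub_blockMatching`
    rcases le_or_gt c i with hci | hic
    · -- `i = c + k` with `k ≤ M`: the gaps `c, …, c + k - 1` lie in the good block.
      obtain ⟨k, rfl⟩ := Nat.exists_eq_add_of_le hci
      have hkM : (k : ℝ) ≤ M := by exact_mod_cast (by omega : k ≤ M)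
      have hup : |y (c + k) - y c - (k : ℝ) * a| ≤ (k : ℝ) * η :=
        blockMatching_upper y a η c k fun l hl => hblock (c + l) (by omega) (by omega)
      have e1 : ((c + k : ℕ) : ℝ) - (c : ℝ) = k := by
        push_cast
        ring
      rw [e1]
      exact hup.trans (mul_le_mul_of_nonneg_right hkM hη)
    · -- `c = i + k` with `k ≤ M`: the gaps `i, …, c - 1` lie in the good block.
      obtain ⟨k, hk⟩ := Nat.exists_eq_add_of_le hic.le
      subst hk
      have hkM : (k : ℝ) ≤ M := by exact_mod_cast (by omega : k ≤ M)
      have hup : |y (i + k) - y i - (k : ℝ) * a| ≤ (k : ℝ) * η :=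
        blockMatching_upper y a η i k fun l hl => hblock (i + l) (by omega) (by omega)
      have e1 : y i - y (i + k) - ((i : ℝ) - ((i + k : ℕ) : ℝ)) * a
          = -(y (i + k) - y i - (k : ℝ) * a) := by
        push_cast
        ring
      rw [e1, abs_neg]
      exact hup.trans (mul_le_mul_of_nonneg_right hkM hη)

/-- **Registered stub `stub_localCardBad`** — LOCAL MATCHING COUNT (`pos1d_card_bad_le` with the global minimal-gap
hypothesis replaced by a local one): for a strictly increasing `y` enumerating (after `σ`) an `N`-point configuration
`x` of the line, with `K = ⌈2R⌉ + 1` and `η = min(ε/K, 1/4)`, a rank `j` with `K ≤ j`, `j + K < N` and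
`|gap_l − a| ≤ η` for all `j − K ≤ l < j + K` is a GOOD particle (those gaps are `≥ a − 1/4 ≥ 1/2`, so ranks at index
distance `≥ K` are farther than `K/2 > R`, ranks within `K` are cumulatively `Kη ≤ ε`-close to `x_j + aℤ`, and the
sites `ka`, `|ka| ≤ R`, have `|k| ≤ 4R/3 < K`); every other rank is within `K` of an end or of an `η`-bad gap, so the
bad particles number at most `2K + 2K·#{η-bad gaps}`. [folklore] -/
theorem stub_localCardBad : ∀ (a : ℝ) (P : PeriodicConfiguration 1) (e : ℤ ≃ P.points), 3 / 4 ≤ a →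
    (∀ k : ℤ, ((e k : P.points) : EuclideanSpace ℝ (Fin 1)) = EuclideanSpace.single (0 : Fin 1) ((k : ℝ) * a)) →
    ∀ (R ε : ℝ), 0 < R → 0 < ε →
    ∀ (N : ℕ) (x : Fin N → EuclideanSpace ℝ (Fin 1)) (σ : Equiv.Perm (Fin N)) (y : ℕ → ℝ),
      (∀ i j : ℕ, i < j → j < N → y i < y j) →
      (∀ i : Fin N, x (σ i) = EuclideanSpace.single (0 : Fin 1) (y i)) →
      ((Nat.card {i : Fin N // ¬ ∃ A : EuclideanSpace ℝ (Fin 1) →ₗᵢ[ℝ] EuclideanSpace ℝ (Fin 1),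
          (∀ p ∈ P.points, ‖p‖ ≤ R → ∃ j : Fin N, dist (x j) (x i + A p) ≤ ε) ∧
          (∀ j : Fin N, dist (x j) (x i) ≤ R → ∃ p ∈ P.points, dist (x j) (x i + A p) ≤ ε)} : ℕ) : ℝ) ≤
        2 * (⌈2 * R⌉₊ + 1 : ℕ) + 2 * (⌈2 * R⌉₊ + 1 : ℕ) *
          (((Finset.range (N - 1)).filter (fun l =>
              min (ε / (⌈2 * R⌉₊ + 1 : ℕ)) (1 / 4) < |a - (y (l + 1) - y l)|)).card : ℝ) := by
  intro a P e ha34 he R ε hR hε N x σ y hmono hyx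
  set K : ℕ := ⌈2 * R⌉₊ + 1 with hKdef
  set η : ℝ := min (ε / K) (1 / 4) with hηdef
  set B : Finset ℕ := (Finset.range (N - 1)).filter (fun l => η < |a - (y (l + 1) - y l)|) with hBdef
  classical
  have hK1 : (1 : ℝ) ≤ K := by
    simp only [hKdef]; push_cast; linarith [(Nat.cast_nonneg (⌈2 * R⌉₊) : (0 : ℝ) ≤ _)]
  have hKpos : (0 : ℝ) < K := by linarith
  have hηle : η ≤ ε / K := min_le_left _ _
  have hη4 : η ≤ 1 / 4 := min_le_right _ _
  have hη : 0 < η := lt_min (div_pos hε hKpos) (by norm_num)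
  have hKη : (K : ℝ) * η ≤ ε := by
    calc (K : ℝ) * η ≤ K * (ε / K) := mul_le_mul_of_nonneg_left hηle hKpos.le
      _ = ε := by field_simp
  have hRK : 2 * R + 1 ≤ K := by
    simp only [hKdef]; push_cast; linarith [Nat.le_ceil (2 * R)]
  have hK2R : R < (K : ℝ) / 2 := by linarith
  have ha : 0 < a := by linarith
  -- coordinates of the particles
  have hcoord : ∀ i : Fin N, x i 0 = y ((σ.symm i : Fin N) : ℕ) := fun i => by
    have h1 := hyx (σ.symm i)
    rw [Equiv.apply_symm_apply] at h1
    rw [h1]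
    simp only [PiLp.single_apply, if_true]
  -- the bad predicate and the excused ranks
  let Q : Fin N → Prop := fun i => ¬ ∃ A : EuclideanSpace ℝ (Fin 1) →ₗᵢ[ℝ] EuclideanSpace ℝ (Fin 1),
        (∀ p ∈ P.points, ‖p‖ ≤ R → ∃ j : Fin N, dist (x j) (x i + A p) ≤ ε) ∧
        (∀ j : Fin N, dist (x j) (x i) ≤ R → ∃ p ∈ P.points, dist (x j) (x i + A p) ≤ ε)
  let badGap : ℕ → Prop := fun l => η < |a - (y (l + 1) - y l)|
  let T : Finset (Fin N) := Finset.univ.filter fun j : Fin N =>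
    (j : ℕ) < K ∨ N ≤ (j : ℕ) + K ∨ ∃ l : ℕ, l + 1 < N ∧ badGap l ∧ (j : ℕ) ≤ l + K ∧ l < (j : ℕ) + K
  -- (i) a rank outside `T` is a good particle
  have hgood : ∀ j : Fin N, j ∉ T → ¬ Q (σ j) := by
    intro j hjT hQ
    simp only [T, Finset.mem_filter, Finset.mem_univ, true_and, not_or, not_lt, not_le, not_exists,
      not_and] at hjT
    obtain ⟨hjK, hjN, hjl⟩ := hjT
    have hblk : ∀ i : ℕ, (j : ℕ) - K ≤ i → i < (j : ℕ) + K → |y (i + 1) - y i - a| ≤ η := by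
      intro i hi1 hi2
      rw [abs_sub_comm]
      by_contra hbad
      have := hjl i (by omega) (not_le.1 hbad) (by omega)
      omega
    obtain ⟨hfarR, hfarL, hnear⟩ :=
      slackCount_localMatching N j K y a η hmono hblk hjK hjN hη.le hη4 ha34
    apply hQ
    refine ⟨LinearIsometry.id, fun p hp hpR => ?_, fun j' hj' => ?_⟩
    · -- sites → particles
      obtain ⟨k, hk⟩ := e.surjective ⟨p, hp⟩
      have hpk : p = EuclideanSpace.single (0 : Fin 1) ((k : ℝ) * a) := by
        have h1 := he k; rw [hk] at h1; exact h1
      have hkabs : |(k : ℝ)| ≤ 4 * R / 3 := by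
        rw [hpk, StickyChain.norm_eq_abs] at hpR
        simp only [PiLp.single_apply, if_true, abs_mul, abs_of_pos ha] at hpR
        have h1 : |(k : ℝ)| ≤ R / a := (le_div_iff₀ ha).2 hpR
        have h2 : R / a ≤ R / (3 / 4) := div_le_div_of_nonneg_left hR.le (by norm_num) ha34
        linarith
      obtain ⟨hk1, hk2⟩ := abs_le.1 (show |(k : ℝ)| ≤ K by linarith)
      have hk1' : -(K : ℤ) ≤ k := by exact_mod_cast hk1
      have hk2' : k ≤ (K : ℤ) := by exact_mod_cast hk2
      obtain ⟨i, hi⟩ : ∃ i : ℕ, (i : ℤ) = (j : ℤ) + k :=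
        ⟨Int.toNat ((j : ℤ) + k), Int.toNat_of_nonneg (by omega)⟩
      have hiN : i < N := by omega
      have hiR : (i : ℝ) - (j : ℕ) = k := by
        have h1 : ((i : ℤ) : ℝ) = ((((j : ℕ) : ℤ) + k : ℤ) : ℝ) := by rw [hi]
        push_cast at h1
        linarith
      refine ⟨σ ⟨i, hiN⟩, ?_⟩
      rw [StickyChain.dist_eq_abs_sub, hcoord, Equiv.symm_apply_apply, PiLp.add_apply, hcoord,
        Equiv.symm_apply_apply, LinearIsometry.id_apply, hpk]
      simp only [PiLp.single_apply, if_true]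
      have h1 := hnear i (by omega) (by omega)
      rw [hiR] at h1
      calc |y i - (y (j : ℕ) + (k : ℝ) * a)| = |y i - y (j : ℕ) - (k : ℝ) * a| := by ring_nf
        _ ≤ K * η := h1
        _ ≤ ε := hKη
    · -- particles → sites
      set i : ℕ := ((σ.symm j' : Fin N) : ℕ) with hidef
      have hiN : i < N := (σ.symm j').2
      rw [StickyChain.dist_eq_abs_sub, hcoord, hcoord, Equiv.symm_apply_apply] at hj'
      rw [← hidef] at hj'
      have hiblk : (j : ℕ) - K ≤ i ∧ i ≤ (j : ℕ) + K := by
        obtain ⟨h1, h2⟩ := abs_le.1 hj'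
        constructor
        · by_contra hlt
          have h' := hfarL i (by omega)
          linarith
        · by_contra hlt
          have h' := hfarR i hiN (by omega)
          linarith
      refine ⟨(e ((i : ℤ) - (j : ℕ)) : EuclideanSpace ℝ (Fin 1)), (e _).2, ?_⟩
      rw [StickyChain.dist_eq_abs_sub, hcoord, PiLp.add_apply, hcoord, Equiv.symm_apply_apply,
        LinearIsometry.id_apply, he]
      simp only [PiLp.single_apply, if_true]
      have h1 := hnear i hiblk.1 hiblk.2
      rw [← hidef]
      push_cast
      calc |y i - (y (j : ℕ) + ((i : ℝ) - (j : ℕ)) * a)|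
          = |y i - y (j : ℕ) - ((i : ℝ) - (j : ℕ)) * a| := by ring_nf
        _ ≤ K * η := h1
        _ ≤ ε := hKη
  -- (ii) counting: the bad particles inject into `T`
  have hcardQ : Nat.card {i : Fin N // Q i} ≤ T.card := by
    rw [Nat.card_eq_fintype_card, Fintype.card_subtype]
    calc (Finset.univ.filter fun i => Q i).card ≤ (T.image σ).card := by
          refine Finset.card_le_card fun i hi => ?_
          rw [Finset.mem_filter] at hi
          rw [Finset.mem_image]
          refine ⟨σ.symm i, ?_, σ.apply_symm_apply i⟩
          by_contra hT
          exact hgood (σ.symm i) hT (by rw [σ.apply_symm_apply]; exact hi.2)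
      _ ≤ T.card := Finset.card_image_le
  -- (iii) counting `T`
  have hTcard : T.card ≤ K + K + B.card * (2 * K) := by
    have hsub : T ⊆ (Finset.univ.filter fun j : Fin N => (j : ℕ) < K) ∪
        (Finset.univ.filter fun j : Fin N => N ≤ (j : ℕ) + K) ∪
        B.biUnion (fun l => Finset.univ.filter fun j : Fin N => (j : ℕ) ≤ l + K ∧ l < (j : ℕ) + K) := by
      intro j hj
      simp only [T, Finset.mem_filter, Finset.mem_univ, true_and] at hj
      simp only [Finset.mem_union, Finset.mem_filter, Finset.mem_univ, true_and, Finset.mem_biUnion, hBdef,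
        Finset.mem_range]
      rcases hj with h | h | ⟨l, hl1, hl2, hl3, hl4⟩
      · exact Or.inl (Or.inl h)
      · exact Or.inl (Or.inr h)
      · exact Or.inr ⟨l, ⟨by omega, hl2⟩, hl3, hl4⟩
    refine (Finset.card_le_card hsub).trans ?_
    refine (Finset.card_union_le _ _).trans (add_le_add ((Finset.card_union_le _ _).trans (add_le_add ?_ ?_)) ?_)
    · calc (Finset.univ.filter fun j : Fin N => (j : ℕ) < K).card
          = ((Finset.univ.filter fun j : Fin N => (j : ℕ) < K).image Fin.val).card :=
            (Finset.card_image_of_injective _ Fin.val_injective).symm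
        _ ≤ (Finset.range K).card := by
            refine Finset.card_le_card fun m hm => ?_
            simp only [Finset.mem_image, Finset.mem_filter, Finset.mem_univ, true_and] at hm
            obtain ⟨j, h1, rfl⟩ := hm
            exact Finset.mem_range.2 h1
        _ = K := Finset.card_range K
    · calc (Finset.univ.filter fun j : Fin N => N ≤ (j : ℕ) + K).card
          = ((Finset.univ.filter fun j : Fin N => N ≤ (j : ℕ) + K).image Fin.val).card :=
            (Finset.card_image_of_injective _ Fin.val_injective).symm
        _ ≤ (Finset.Ico (N - K) N).card := by
            refine Finset.card_le_card fun m hm => ?_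
            simp only [Finset.mem_image, Finset.mem_filter, Finset.mem_univ, true_and] at hm
            obtain ⟨j, h1, rfl⟩ := hm
            rw [Finset.mem_Ico]
            omega
        _ ≤ K := by rw [Nat.card_Ico]; omega
    · exact Finset.card_biUnion_le.trans (Finset.sum_le_card_nsmul _ _ _ fun l _ => pos1d_card_window_le N l K)
  -- (iv) assemble in `ℝ`
  have h1 : ((Nat.card {i : Fin N // Q i} : ℕ) : ℝ) ≤ (T.card : ℝ) := by exact_mod_cast hcardQ
  have h2 : ((T.card : ℕ) : ℝ) ≤ K + K + B.card * (2 * K) := by exact_mod_cast hTcard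
  calc ((Nat.card {i : Fin N // Q i} : ℕ) : ℝ) ≤ K + K + B.card * (2 * K) := h1.trans h2
    _ = 2 * (K : ℝ) + 2 * K * (B.card : ℝ) := by ring

end Summit.AtomisticToContinuum.Crystallization.Theorems.ThreeConeCertificateExactCertificate.Transfer1D

end
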